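import Summits.Ventures.PercRepro.C025ProfileRankFourLemmas

/-!
# The rank-4 certificate: (Cap)(c), the structure of a four-point set with a collinear triple (night-3 g8)

NIGHT3-G7-RANK4-CERTIFICATE.md §3(c): a rank-`3` set `S = T₀ ∪ {u}` with `|S| = 4`, `T₀` a collinear triple
(`ρ(T₀) = 2`) and `u` off its line `L = cl T₀`. The rank-`2` subsets of `S` are `T₀` itself (the only rank-`2` triple:
any other triple contains `u` and two points of `L`, hence spans a plane) and the six pairs — three INNER pairs inside
`T₀` and three `u`-PAIRS `{x, u}`. This module proves the counting lemma **`cap_sum_le_of_bounds`**: if `T₀` pays at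
most `c₀`, every inner pair at most `c₁` and every `u`-pair at most `c₂`, the total is at most `c₀ + 3c₁ + 3c₂`. The
per-type bounds by `r = ρ(E∖S)` are in `C025ProfileRankFourCapCB`; the case assembly in `C025ProfileRankFourCapC`.
-/

open scoped Matroid

namespace PercRepro

open Set Finset ThmH

section CapCA

variable {α : Type} [DecidableEq α] {M : Matroid α} [M.Finite]

/-- In a simple matroid, a triple `{a, b, u}` with `a ≠ b` on a line `L = cl T₀` (`ρ(T₀) = 2`) and `u ∉ L` has rank
`3`. -/
theorem eRk_eq_three_of_two_mem_line (hsimple : ∀ T ⊆ M.E, T.encard ≤ 2 → M.Indep T) {T₀ B : Finset α}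
    (hT₀g : T₀ ⊆ gr M) (hT₀2 : M.eRk (T₀ : Set α) = 2) {u : α} (huE : u ∈ M.E) (huL : u ∉ clF M T₀)
    (hB : B ⊆ insert u T₀) (huB : u ∈ B) {a b : α} (hab : a ≠ b) (ha : a ∈ B) (hb : b ∈ B)
    (haT : a ∈ T₀) (hbT : b ∈ T₀) : M.eRk (B : Set α) = 3 := by
  -- B = insert u (B.erase u), and B.erase u ⊆ T₀ contains a, b
  have hBe : B = insert u (B.erase u) := (Finset.insert_erase huB).symm
  have hBT : B.erase u ⊆ T₀ := by
    intro x hx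
    rw [Finset.mem_erase] at hx
    have := hB hx.2
    rw [Finset.mem_insert] at this
    rcases this with h | h
    · exact absurd h hx.1
    · exact h
  have hau : a ≠ u := by rintro rfl; exact huL (subset_clF_self hT₀g haT)
  have hbu : b ≠ u := by rintro rfl; exact huL (subset_clF_self hT₀g hbT)
  have haBe : a ∈ B.erase u := Finset.mem_erase.2 ⟨hau, ha⟩
  have hbBe : b ∈ B.erase u := Finset.mem_erase.2 ⟨hbu, hb⟩
  -- the closure of B ∖ u is the line L
  have hBeg : B.erase u ⊆ gr M := hBT.trans hT₀g
  have hBe2 : M.eRk ((B.erase u : Finset α) : Set α) = 2 := by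
    apply le_antisymm
    · calc M.eRk ((B.erase u : Finset α) : Set α) ≤ M.eRk (T₀ : Set α) := M.eRk_mono (Finset.coe_subset.2 hBT)
        _ = 2 := hT₀2
    · exact two_le_eRk_of_pair_subset hsimple hBeg haBe hbBe hab
  have hcl : M.closure ((B.erase u : Finset α) : Set α) = M.closure (T₀ : Set α) := by
    apply Set.Subset.antisymm (M.closure_subset_closure (Finset.coe_subset.2 hBT))
    have := clF_subset_closure_of_two_mem hsimple hT₀2 hab (subset_clF_self hT₀g haT) (subset_clF_self hT₀g hbT)
      (by exact_mod_cast haBe) (by exact_mod_cast hbBe)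
    rw [coe_clF] at this
    exact this
  have hucl : u ∉ M.closure ((B.erase u : Finset α) : Set α) := by
    rw [hcl, ← coe_clF]; exact_mod_cast huL
  rw [hBe, Finset.coe_insert, M.eRk_insert_eq_add_one ⟨huE, hucl⟩, hBe2]
  rfl

/-- **The counting lemma of (Cap)(c)**: for `S = T₀ ∪ {u}` as above, if `T₀` pays at most `c₀`, every pair inside `T₀`
at most `c₁` and every pair `{x, u}` at most `c₂`, then `S` is paid at most `c₀ + 3c₁ + 3c₂`. -/
theorem cap_sum_le_of_bounds (hsimple : ∀ T ⊆ M.E, T.encard ≤ 2 → M.Indep T) {S T₀ : Finset α} {u : α}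
    (hS : S ∈ Shadow.levelSet M 3) (hS4 : S.card = 4) (hT₀S : T₀ ⊆ S) (hT₀c : T₀.card = 3)
    (hT₀2 : M.eRk (T₀ : Set α) = 2) (huS : u ∈ S) (huT : u ∉ T₀) {c₀ c₁ c₂ : ℚ}
    (h₀ : w4n M T₀ S ≤ c₀) (h₁ : ∀ B ⊆ T₀, B.card = 2 → w4n M B S ≤ c₁)
    (h₂ : ∀ B ⊆ S, B.card = 2 → u ∈ B → w4n M B S ≤ c₂) :
    ∑ B ∈ (Profile.Rq M 2).filter (fun B => B ⊆ S), w4n M B S ≤ c₀ + 3 * c₁ + 3 * c₂ := by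
  classical
  set Φ := (Profile.Rq M 2).filter (fun B => B ⊆ S) with hΦ
  have hSg : S ⊆ gr M := (Profile.mem_levelSet.1 hS).1
  have hT₀g : T₀ ⊆ gr M := hT₀S.trans hSg
  have huE : u ∈ M.E := by rw [← coe_gr]; exact_mod_cast hSg huS
  have hSeq : S = insert u T₀ := by
    apply Finset.eq_of_subset_of_card_le
    · intro x hx
      rw [Finset.mem_insert]
      by_cases hxu : x = u
      · exact Or.inl hxu
      · right
        by_contra hxT
        -- then insert x T₀ ⊆ S.erase u has 4 points, but S.erase u has 3
        have hsub : insert x (insert u T₀) ⊆ S := by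
          intro w hw
          rw [Finset.mem_insert, Finset.mem_insert] at hw
          rcases hw with rfl | rfl | hw
          · exact hx
          · exact huS
          · exact hT₀S hw
        have := Finset.card_le_card hsub
        rw [Finset.card_insert_of_notMem, Finset.card_insert_of_notMem huT, hT₀c, hS4] at this
        · omega
        · rw [Finset.mem_insert, not_or]; exact ⟨hxu, hxT⟩
    · rw [Finset.card_insert_of_notMem huT, hT₀c, hS4]
  -- u is off the line of T₀
  have huL : u ∉ clF M T₀ := by
    intro h
    rw [← Finset.mem_coe, coe_clF] at h
    have : M.eRk (S : Set α) ≤ 2 := by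
      calc M.eRk (S : Set α) ≤ M.eRk (M.closure (T₀ : Set α)) := by
            apply M.eRk_mono
            rw [hSeq, Finset.coe_insert]
            exact Set.insert_subset h (M.subset_closure _ (by rw [← coe_gr]; exact_mod_cast hT₀g))
        _ = 2 := by rw [M.eRk_closure_eq, hT₀2]
    rw [(Profile.mem_levelSet.1 hS).2] at this
    exact absurd this (by decide)
  -- every member of Φ has two or three points
  have hcard : ∀ B ∈ Φ, B.card = 2 ∨ B.card = 3 := by
    intro B hB
    have hBS : B ⊆ S := (Finset.mem_filter.1 hB).2
    have h2 := two_le_card_of_mem_Rq_two (Finset.mem_filter.1 hB).1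
    have hne := ne_of_mem_filter_levelSet hS hB
    have hle := Finset.card_le_card hBS
    have hB4 : B.card ≠ 4 := by
      intro h4
      exact hne (Finset.eq_of_subset_of_card_le hBS (by omega))
    omega
  -- the only rank-2 triple is T₀
  have htriple : ∀ B ∈ Φ, B.card = 3 → B = T₀ := by
    intro B hB hB3
    have hBS : B ⊆ S := (Finset.mem_filter.1 hB).2
    have hB2 : M.eRk (B : Set α) = 2 := (Profile.mem_Rq.1 (Finset.mem_filter.1 hB).1).2
    by_contra hne
    have huB : u ∈ B := by
      by_contra huB
      apply hne
      apply Finset.eq_of_subset_of_card_le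
      · intro x hx
        have := hBS hx
        rw [hSeq, Finset.mem_insert] at this
        rcases this with rfl | h
        · exact absurd hx huB
        · exact h
      · omega
    -- two points of B other than u, both in T₀
    have hc : 2 ≤ (B.erase u).card := by rw [Finset.card_erase_of_mem huB]; omega
    obtain ⟨U, hUB, hUc⟩ := Finset.exists_subset_card_eq hc
    obtain ⟨a, b, hab, hU⟩ := Finset.card_eq_two.1 hUc
    have haB : a ∈ B.erase u := hUB (by rw [hU]; exact Finset.mem_insert_self _ _)
    have hbB : b ∈ B.erase u := hUB (by rw [hU]; exact Finset.mem_insert_of_mem (Finset.mem_singleton_self _))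
    have hmemT : ∀ x ∈ B.erase u, x ∈ T₀ := by
      intro x hx
      rw [Finset.mem_erase] at hx
      have := hBS hx.2
      rw [hSeq, Finset.mem_insert] at this
      rcases this with h | h
      · exact absurd h hx.1
      · exact h
    have h3 := eRk_eq_three_of_two_mem_line hsimple hT₀g hT₀2 huE huL (by rw [← hSeq]; exact hBS) huB hab
      (Finset.mem_erase.1 haB).2 (Finset.mem_erase.1 hbB).2 (hmemT a haB) (hmemT b hbB)
    rw [hB2] at h3
    exact absurd h3 (by decide)
  -- split Φ by cardinality
  have hsplit : ∑ B ∈ Φ, w4n M B S =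
      ∑ B ∈ Φ.filter (fun B => B.card = 3), w4n M B S + ∑ B ∈ Φ.filter (fun B => ¬ B.card = 3), w4n M B S :=
    (Finset.sum_filter_add_sum_filter_not _ _ _).symm
  have hpart3 : ∑ B ∈ Φ.filter (fun B => B.card = 3), w4n M B S ≤ c₀ := by
    have hsub : Φ.filter (fun B => B.card = 3) ⊆ {T₀} := by
      intro B hB
      rw [Finset.mem_filter] at hB
      rw [Finset.mem_singleton]
      exact htriple B hB.1 hB.2
    calc ∑ B ∈ Φ.filter (fun B => B.card = 3), w4n M B S ≤ ∑ B ∈ ({T₀} : Finset (Finset α)), w4n M B S :=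
          Finset.sum_le_sum_of_subset_of_nonneg hsub (fun B _ _ => w4n_nonneg B S)
      _ = w4n M T₀ S := Finset.sum_singleton _ _
      _ ≤ c₀ := h₀
  have hpart2 : ∑ B ∈ Φ.filter (fun B => ¬ B.card = 3), w4n M B S ≤ 3 * c₁ + 3 * c₂ := by
    have hsub : Φ.filter (fun B => ¬ B.card = 3) ⊆ S.powersetCard 2 := by
      intro B hB
      rw [Finset.mem_filter] at hB
      rw [Finset.mem_powersetCard]
      refine ⟨(Finset.mem_filter.1 hB.1).2, ?_⟩
      rcases hcard B hB.1 with h | h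
      · exact h
      · exact absurd h hB.2
    -- the pairs of S: those inside T₀ and those through u
    have hsplit2 : ∑ B ∈ S.powersetCard 2, w4n M B S =
        ∑ B ∈ (S.powersetCard 2).filter (fun B => u ∈ B), w4n M B S +
          ∑ B ∈ (S.powersetCard 2).filter (fun B => ¬ u ∈ B), w4n M B S :=
      (Finset.sum_filter_add_sum_filter_not _ _ _).symm
    have hin : (S.powersetCard 2).filter (fun B => ¬ u ∈ B) = T₀.powersetCard 2 := by
      ext B
      rw [Finset.mem_filter, Finset.mem_powersetCard, Finset.mem_powersetCard]
      constructor
      · rintro ⟨⟨hBS, hBc⟩, huB⟩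
        refine ⟨?_, hBc⟩
        intro x hx
        have := hBS hx
        rw [hSeq, Finset.mem_insert] at this
        rcases this with rfl | h
        · exact absurd hx huB
        · exact h
      · rintro ⟨hBT, hBc⟩
        exact ⟨⟨hBT.trans hT₀S, hBc⟩, fun h => huT (hBT h)⟩
    have hcard_in : ((S.powersetCard 2).filter (fun B => ¬ u ∈ B)).card = 3 := by
      rw [hin, Finset.card_powersetCard, hT₀c]; decide
    have hcard_u : ((S.powersetCard 2).filter (fun B => u ∈ B)).card = 3 := by
      have htot := Finset.card_filter_add_card_filter_not (s := S.powersetCard 2) (fun B => u ∈ B)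
      rw [hcard_in, Finset.card_powersetCard, hS4] at htot
      have : Nat.choose 4 2 = 6 := by decide
      omega
    have hb_u : ∑ B ∈ (S.powersetCard 2).filter (fun B => u ∈ B), w4n M B S ≤ 3 * c₂ := by
      calc ∑ B ∈ (S.powersetCard 2).filter (fun B => u ∈ B), w4n M B S
          ≤ ∑ _B ∈ (S.powersetCard 2).filter (fun B => u ∈ B), c₂ := by
            apply Finset.sum_le_sum
            intro B hB
            rw [Finset.mem_filter, Finset.mem_powersetCard] at hB
            exact h₂ B hB.1.1 hB.1.2 hB.2
        _ = 3 * c₂ := by rw [Finset.sum_const, nsmul_eq_mul, hcard_u]; push_cast; ring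
    have hb_in : ∑ B ∈ (S.powersetCard 2).filter (fun B => ¬ u ∈ B), w4n M B S ≤ 3 * c₁ := by
      calc ∑ B ∈ (S.powersetCard 2).filter (fun B => ¬ u ∈ B), w4n M B S
          ≤ ∑ _B ∈ (S.powersetCard 2).filter (fun B => ¬ u ∈ B), c₁ := by
            apply Finset.sum_le_sum
            intro B hB
            rw [hin, Finset.mem_powersetCard] at hB
            exact h₁ B hB.1 hB.2
        _ = 3 * c₁ := by rw [Finset.sum_const, nsmul_eq_mul, hcard_in]; push_cast; ring
    calc ∑ B ∈ Φ.filter (fun B => ¬ B.card = 3), w4n M B S ≤ ∑ B ∈ S.powersetCard 2, w4n M B S :=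
          Finset.sum_le_sum_of_subset_of_nonneg hsub (fun B _ _ => w4n_nonneg B S)
      _ = _ := hsplit2
      _ ≤ 3 * c₂ + 3 * c₁ := add_le_add hb_u hb_in
      _ = 3 * c₁ + 3 * c₂ := by ring
  rw [hsplit]
  linarith

end CapCA

end PercRepro
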